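import Summits.Ventures.HSemireg.GeneralStructureWiringObjClass
import Summits.HodgeConjecture.HodgeConjecture.Theorems.PadicSemiregularLiftHodgeAbelianVarietiesStubCmAnchoredFamilies
import HarnessLib

/-!
# HSemireg venture · general structure — the DEFORMATION-FREE instance (★) of the door-agnostic uniform lift `UniformObjLiftAtCM 𝒪`
# (red-team GS-9 kernel-exact for EVERY door; the cheapest falsifier of the team's hypothesis on the perfect-complex door)

HONEST FRAMING (cell `pub-hsemireg`, team «general structure», seat G4 = gs-g4; verbatim the cell's rule): nothing here says
`HC`, `HC_AV` or `HC_CM` is proved. This file asserts NOTHING: it SPECIALISES seat G4's `@[conjecture]` hypothesis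
`UniformObjLiftAtCM 𝒪` (which is NOT asserted) to the constant family over the point and records what it then says. No `sorry`,
no new `def`, no new axiom, no Literature fact; axioms ⊆ {propext, Classical.choice, Quot.sound}.

## Content (companion of `GeneralStructureStar.lean`, which does the same for the sheaf ∀-form)

Every door `𝒪`: `UniformObjLiftAtCM 𝒪` ENTAILS the deformation-free statement

  (★_𝒪)  for every CM abelian variety `A₀`, every `p` and every class `α ∈ H^{2p}(A₀(ℂ); ℂ)` that is rational, of type `(p,p)`
         AND algebraic, there are a model `e : X₀ ≅ A₀`, finitely many `𝒪`-admissible class families `κ_i` on `X₀` (degree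
         sets `I_i ∋ p`, relative dimension `dim A₀`) and `c_i ∈ ℂ` with `α = Σ c_i (e⁻¹)^*κ_{i,p}`,

because the base `Spec ℂ` with the constant family `A₀ ⟶ Spec ℂ` satisfies every antecedent (ring 2's `unit_base`,
`isSmoothProjectiveFamily_toUnit`, `fibreIncl_toUnit`, `hodgeAlong_toUnit`) and over a one-point base the horizontality clause is
idle; the fibre `A₀ ×_{Spec ℂ} u` is identified with `A₀` by `fiberι` (`isIso_fiberι_toUnit`), and the model is composed with
that identification, so (★_𝒪) is stated ON `A₀` ITSELF; under `HC_CM` (by name) the algebraicity hypothesis drops: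
(★★_𝒪) `presentationAtCM_of_hc_cm_of_uniformObjLift`, every rational `(p,p)` class on every CM abelian variety. Contrapositive (`not_uniformObjLift_of_noPresentation`): ONE CM abelian
variety with ONE rational algebraic `(p,p)` class admitting NO `𝒪`-presentation on any model refutes `UniformObjLiftAtCM 𝒪` — for
`𝒪 = perfectObjClass C gluableSigmaAdmissible` this is the kernel form of the question the cell's census asks of each Weil class
at `E^{2n}` (a census NO on finitely many FAMILIES of complexes is evidence, not a proof of «no presentation»). Consequence for
the report (numbers, not adjectives): as for the sheaf form (GS-9), (★_𝒪) is automatic where the Hodge ring is divisor-generated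
as soon as the door admits line bundles (sheaf door; gluable-σ door with `{1..dim} ⊆ I`: `σ₀ = trace` is bijective on
`Ext²(L, L)`, cf. `perfectObjClass_gluable_single₀`), and has content exactly for the exceptional classes in degrees
`2 ≤ p ≤ dim - 2`.

## References (bib keys)

BuchweitzFlenner2003 (§5 Thm. 5.1, Def. 4.1), Pridham2024Semiregularity (Cor. 2.25), Fulton1998 (Ex. 15.2.16 (b)), MumfordAV1970 (§22).
-/

noncomputable section

open CategoryTheory MonoidalCategory
open Literature.AlgebraicGeometry Literature.AlgebraicGeometry.Motives
open Literature.AlgebraicGeometry.HodgeTheory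

namespace Summit.Ventures.HSemireg.GeneralStructure

open Summit.HodgeConjecture.HodgeConjecture
open Summit.HodgeConjecture.HodgeConjecture.Cruxes.HodgeAbelianVarieties.SubtorusGalleryBlochSeeds.Stubs
  (unit_base isSmoothProjectiveFamily_toUnit fibreIncl_toUnit hodgeAlong_toUnit isIso_fiberι_toUnit)
open Summit.HodgeConjecture.HodgeConjecture.Theorems.HodgeAbelianVarieties.CMPivot (hodgeCM_of_cmAbelianHodge)

/-- **(★_𝒪) from the door-agnostic ∀-form — GS-9 kernel-exact for every door.** If `UniformObjLiftAtCM 𝒪` holds then on every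
CM abelian variety `A₀` every rational, `(p,p)`, ALGEBRAIC class `α` has an `𝒪`-admissible presentation on a model of `A₀`:
`α = Σ c_i (e⁻¹)^*κ_{i,p}` with `e : X₀ ≅ A₀`, `p ∈ I_i`, `𝒪 (dim A₀) X₀ I_i κ_i` — the hypothesis specialised to the constant
family over the point (every antecedent discharged by ring-2 tree theorems; the horizontality clause dropped; the fibre of the
constant family identified with `A₀` by `fiberι`, an isomorphism). NOT asserted: the hypothesis is the team's OPEN, SPECULATIVE
`@[conjecture]` def. [cite: BuchweitzFlenner2003, §5 Thm. 5.1 and Def. 4.1] [cite: MumfordAV1970, §22 (CM type)] -/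
theorem presentationAtCM_of_uniformObjLift {𝒪 : ObjClass} (hL : UniformObjLiftAtCM 𝒪) (A₀ : AbelianVariety ℂ)
    (hCM : ∃ (ψ : A₀ ⟶ A₀) (μ : Fin (2 * AbelianVariety.dim A₀) → ℂ), Function.Injective μ ∧
      ∀ i, Module.End.HasEigenvalue (HodgeTheory.complexBetti.map ψ.hom.hom.hom 1).hom (μ i))
    (p : ℕ) (α : HodgeTheory.complexBetti A₀.X (2 * p)) (hrat : IsRationalClass α)
    (halg : α ∈ HodgeTheory.algebraicClasses A₀.X p) :
    ∃ (X₀ : SchemeOver ℂ) (e : X₀ ≅ A₀.X) (r : ℕ) (c : Fin r → ℂ) (I : Fin r → Finset ℕ)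
      (κ : Fin r → (q : ℕ) → complexBetti X₀ (2 * q)),
      (∀ i, p ∈ I i) ∧ (∀ i, 𝒪 A₀.dim X₀ (I i) (κ i)) ∧ α = ∑ i, c i • complexBetti.map e.inv (2 * p) (κ i p) := by
  have hX : IsSmoothProjective A₀.dim A₀.X := AbelianVariety.isSmoothProjective_holds
  have hh : IsOfHodgeType A₀.dim A₀.X (2 * p) p p α :=
    isOfHodgeType_of_mem_algebraicClasses_of_isSmoothProjective hX p halg
  have halg' : HodgeTheory.complexBetti.map (𝟙 A₀.X) (2 * p) α ∈ HodgeTheory.algebraicClasses A₀.X p := by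
    rw [HodgeTheory.complexBetti.map_id]; exact halg
  let u : ComplexPoints (𝟙_ (SchemeOver ℂ)) := CartesianMonoidalCategory.toUnit _
  obtain ⟨U, hu, -, X₀, e, r, c, I, κ, hp, hκ, hsum, -⟩ :=
    hL (𝟙_ (SchemeOver ℂ)) A₀.X (CartesianMonoidalCategory.toUnit A₀.X) A₀.dim p α u A₀ (𝟙 A₀.X)
      (HodgeTheory.IsQuasiProjectiveOver.of_isProjectiveOver hX.isProjectiveOver) unit_base.1 unit_base.2.1
      unit_base.2.2 (isSmoothProjectiveFamily_toUnit A₀) (fibreIncl_toUnit A₀ u) hCM halg' (hodgeAlong_toUnit hrat hh)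
  -- identify the fibre of the constant family with `A₀` and compose the model with that identification
  haveI := isIso_fiberι_toUnit A₀ u
  let ι : fiberOver (CartesianMonoidalCategory.toUnit A₀.X) u ≅ A₀.X := asIso (fiberι (CartesianMonoidalCategory.toUnit A₀.X) u)
  refine ⟨X₀, e ≪≫ ι, r, c, I, κ, hp, hκ, ?_⟩
  have hid : complexBetti.map ι.inv (2 * p) (complexBetti.map ι.hom (2 * p) α) = α :=
    ι.symm.complexBetti_map_hom_map_inv (2 * p) α
  have hlin : complexBetti.map ι.inv (2 * p) (∑ i, c i • complexBetti.map e.inv (2 * p) (κ i p)) =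
      ∑ i, c i • complexBetti.map ι.inv (2 * p) (complexBetti.map e.inv (2 * p) (κ i p)) := by
    simp only [map_sum, map_smul]
  rw [← hid, show complexBetti.map ι.hom (2 * p) α = _ from hsum, hlin]
  refine Finset.sum_congr rfl fun i _ ↦ ?_
  rw [Iso.trans_inv, complexBetti.map_comp, CategoryTheory.comp_apply]

/-- **(★★_𝒪) — the shadow under `HC_CM`**: granted `HC_CM` (open item stmt-HodgeConjecture-3052, BY NAME, via ring 2's bridge
`CMPivot.hodgeCM_of_cmAbelianHodge`), `UniformObjLiftAtCM 𝒪` says that on every CM abelian variety EVERY rational `(p,p)` class is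
a `ℂ`-combination of `𝒪`-admissible classes on a model — for the perfect-complex door: of Chern characters of gluable σ-semiregular
bounded complexes of vector bundles. This is the statement the census tests class by class at `E^{2n}`. NOT asserted.
[cite: MumfordAV1970, §22 (CM type)] [cite: BuchweitzFlenner2003, §5 Def. 4.1] -/
theorem presentationAtCM_of_hc_cm_of_uniformObjLift {𝒪 : ObjClass} (hCM : Theses.RankFourFaces.CMAbelianHodge)
    (hL : UniformObjLiftAtCM 𝒪) (A₀ : AbelianVariety ℂ)
    (hcm : ∃ (ψ : A₀ ⟶ A₀) (μ : Fin (2 * AbelianVariety.dim A₀) → ℂ), Function.Injective μ ∧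
      ∀ i, Module.End.HasEigenvalue (HodgeTheory.complexBetti.map ψ.hom.hom.hom 1).hom (μ i))
    (p : ℕ) (α : HodgeTheory.complexBetti A₀.X (2 * p)) (hrat : IsRationalClass α)
    (hh : IsOfHodgeType A₀.dim A₀.X (2 * p) p p α) :
    ∃ (X₀ : SchemeOver ℂ) (e : X₀ ≅ A₀.X) (r : ℕ) (c : Fin r → ℂ) (I : Fin r → Finset ℕ)
      (κ : Fin r → (q : ℕ) → complexBetti X₀ (2 * q)),
      (∀ i, p ∈ I i) ∧ (∀ i, 𝒪 A₀.dim X₀ (I i) (κ i)) ∧ α = ∑ i, c i • complexBetti.map e.inv (2 * p) (κ i p) :=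
  presentationAtCM_of_uniformObjLift hL A₀ hcm p α hrat ((hodgeCM_of_cmAbelianHodge hCM A₀ hcm).2 p _ hrat hh)

/-- **Contrapositive, the cheapest falsifier of the door-agnostic ∀-form:** ONE CM abelian variety with ONE rational algebraic
`(p,p)` class admitting no `𝒪`-presentation on any model refutes `UniformObjLiftAtCM 𝒪` (e.g. `𝒪 = perfectObjClass C
gluableSigmaAdmissible`: no `ℂ`-combination of Chern characters of gluable σ-semiregular bounded complexes of vector bundles
equals the class). [cite: BuchweitzFlenner2003, §5 Thm. 5.1 and Def. 4.1] [cite: Pridham2024Semiregularity, Cor. 2.25] -/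
theorem not_uniformObjLift_of_noPresentation {𝒪 : ObjClass} (A₀ : AbelianVariety ℂ)
    (hCM : ∃ (ψ : A₀ ⟶ A₀) (μ : Fin (2 * AbelianVariety.dim A₀) → ℂ), Function.Injective μ ∧
      ∀ i, Module.End.HasEigenvalue (HodgeTheory.complexBetti.map ψ.hom.hom.hom 1).hom (μ i))
    (p : ℕ) (α : HodgeTheory.complexBetti A₀.X (2 * p)) (hrat : IsRationalClass α)
    (halg : α ∈ HodgeTheory.algebraicClasses A₀.X p)
    (hno : ¬ ∃ (X₀ : SchemeOver ℂ) (e : X₀ ≅ A₀.X) (r : ℕ) (c : Fin r → ℂ) (I : Fin r → Finset ℕ)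
      (κ : Fin r → (q : ℕ) → complexBetti X₀ (2 * q)),
      (∀ i, p ∈ I i) ∧ (∀ i, 𝒪 A₀.dim X₀ (I i) (κ i)) ∧ α = ∑ i, c i • complexBetti.map e.inv (2 * p) (κ i p)) :
    ¬ UniformObjLiftAtCM 𝒪 :=
  fun hL ↦ hno (presentationAtCM_of_uniformObjLift hL A₀ hCM p α hrat halg)

/-! ### Calibration (red-team «trivially true?» lens): WITHOUT the admissibility clause the shadow is Fulton's span theorem -/

/-- **Calibration.** On ANY smooth projective `X`, every algebraic class is a finite `ℂ`-combination of Chern characters of vector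
bundles — the `span` field of `ChernCharacterBetti` (Fulton Ex. 15.2.16 (b) / Voisin Thm. 11.32) unpacked into an indexed sum. So the
conclusion shape of (★_𝒪) holds OUTRIGHT for the door «`κ|_I = ch(E)|_I` for some vector bundle `E`» with NO semiregularity clause:
ALL the content of `UniformObjLiftAtCM 𝒪` over the point base is the admissibility clause of `𝒪` (GS-9, now for every door).
[cite: Fulton1998, Example 15.2.16 (b)] [cite: VoisinHodgeI2002, Thm. 11.32] -/
theorem exists_sum_smul_ch_of_mem_algebraicClasses (C : ChernCharacterBetti) {n : ℕ} {X : SchemeOver ℂ}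
    (hX : IsSmoothProjective n X) (p : ℕ) (α : complexBetti X (2 * p)) (halg : α ∈ algebraicClasses X p) :
    ∃ (r : ℕ) (c : Fin r → ℂ) (E : Fin r → X.left.Modules),
      (∀ i, Motives.IsVectorBundle (E i)) ∧ α = ∑ i, c i • C.ch X (E i) p := by
  obtain ⟨f, t, hts, -, hsum⟩ := Submodule.mem_span_iff_exists_finset_subset.1 (C.algebraicClasses_le_span_ch hX p halg)
  have hE : ∀ a : t, ∃ E : X.left.Modules, Motives.IsVectorBundle E ∧ C.ch X E p = a := fun a ↦ hts a.2
  choose E hEvb hEch using hE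
  refine ⟨t.card, fun i ↦ f (t.equivFin.symm i), fun i ↦ E (t.equivFin.symm i), fun i ↦ hEvb _, ?_⟩
  have h1 : ∑ i : Fin t.card, f (t.equivFin.symm i) • C.ch X (E (t.equivFin.symm i)) p =
      ∑ a : t, f a • C.ch X (E a) p :=
    Fintype.sum_equiv t.equivFin.symm _ (fun a : t ↦ f a • C.ch X (E a) p) fun _ ↦ rfl
  rw [h1]
  simp only [hEch]
  rw [Finset.sum_coe_sort t (fun a ↦ f a • a), hsum]

/-- **The same in the exact shape of (★_𝒪)** for the admissibility-free vector-bundle door (`I_i = {p}`, model `Iso.refl`): holds for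
every algebraic class on every smooth projective `X₀` — no CM hypothesis, no lift. [cite: Fulton1998, Example 15.2.16 (b)] -/
theorem presentation_vectorBundleDoor_of_mem_algebraicClasses (C : ChernCharacterBetti) {n : ℕ} {X : SchemeOver ℂ}
    (hX : IsSmoothProjective n X) (p : ℕ) (α : complexBetti X (2 * p)) (halg : α ∈ algebraicClasses X p) :
    ∃ (X₀ : SchemeOver ℂ) (e : X₀ ≅ X) (r : ℕ) (c : Fin r → ℂ) (I : Fin r → Finset ℕ)
      (κ : Fin r → (q : ℕ) → complexBetti X₀ (2 * q)),
      (∀ i, p ∈ I i) ∧ (∀ i, ∃ E : X₀.left.Modules, Motives.IsVectorBundle E ∧ ∀ q ∈ I i, κ i q = C.ch X₀ E q) ∧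
        α = ∑ i, c i • complexBetti.map e.inv (2 * p) (κ i p) := by
  obtain ⟨r, c, E, hE, hsum⟩ := exists_sum_smul_ch_of_mem_algebraicClasses C hX p α halg
  refine ⟨X, Iso.refl _, r, c, fun _ ↦ {p}, fun i q ↦ C.ch X (E i) q, fun _ ↦ Finset.mem_singleton_self p,
    fun i ↦ ⟨E i, hE i, fun _ _ ↦ rfl⟩, ?_⟩
  simpa only [Iso.refl_inv, complexBetti.map_id, CategoryTheory.id_apply] using hsum

end Summit.Ventures.HSemireg.GeneralStructure

end
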